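import Mathlib
import Summits.ValiantsHypothesis.ValiantsHypothesis.Theorems.GrenetZeonPolySizeQPAlgebraSquareZeroResidue
import HarnessLib

/-!
# Crux `GrenetZeon.PolySizeQPAlgebra` (stmt-ValiantsHypothesis-8064), line `vbp-slice-dealg` —
# every coefficient algebra: the Hessian VANISHES at residual corank `≥ ν + 2` (`𝔪^ν = 0`)

The remaining input (B) of the `c = 1` box is `LocalHessianBound₃` (residual corank `q ≥ 3`,
`…LocalReductionResidualThree`).  From the general closed form (`…BlockNormalFormGeneral`) and the
maximal-minor transport (`…MaximalMinorTransport`): if the maximal ideal of the local piece satisfies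
`𝔪^ν = 0` (always with `ν ≤ dim R`), then at residual corank `q ≥ ν + 2` ALL terms of the Hessian of
`λ(det A)` vanish — `det S ∈ 𝔪^q`, `adj S ∈ 𝔪^{q-1}`, the second polarisation has coefficients in
`𝔪^{q-2}`.  So, per local type, only the finitely many residual coranks `3 ≤ q ≤ ν + 1` carry content
(square-zero types, `ν = 2`: only `q = 3`, settled in `…SquareZeroResidue`; `ℂ[x,y]/(x²,y²)`, `ν = 3`: only
`q = 3, 4`).

* `prod_mem_pow_card`, `det_eq_zero_of_rows_mem_pow` — `a` rows in `I` with `I^a = 0` kill a determinant.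
* `det_eq_zero_of_mem_pow`, `adjugate_eq_zero_of_mem_pow`, `det_updateRow_updateRow_eq_zero_of_mem_pow` —
  for `S ∈ Mat_q(I)`, `I^a = 0`: `det S = 0` (`q ≥ a`), `adj S = 0` (`q ≥ a+1`), double row replacements
  singular (`q ≥ a+2`).
* `eval_pderiv_pderiv_det_eq_zero_of_pow`, `hess0_transl_eq_zero_of_pow` — vanishing at normal forms.
* `hess0_transl_rank_eq_zero_of_pow_point` — **for every `R` with a character `φ`, `(ker φ)^ν = 0`, every
  `λ`, affine `A`, and every point with a residually maximal minor of co-size `q ≥ ν + 2`: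
  `rank Hess λ(det A)(p) = 0`.**

HONEST FRAMING: rank theorems at high residual corank; no stub of the line is closed; VP ≠ VNP is not moved.

References: T. Mignon, N. Ressayre, IMRN 2004:79, §2 [MignonRessayre2004].
-/

noncomputable section

open MvPolynomial Matrix
open Literature.Computability.AlgebraicComplexity

-- single-conjunct layout `Summits/ValiantsHypothesis/ValiantsHypothesis`: duplicated namespace by design
set_option linter.dupNamespace false

namespace Summit.ValiantsHypothesis.ValiantsHypothesis.Theorems.GrenetZeonPolySizeQPAlgebra

section PowIdeal

variable {R : Type*} [CommRing R] {m : Type*} [Fintype m] [DecidableEq m]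

omit [Fintype m] [DecidableEq m] in
/-- A product of elements of `I` over a finset `T` lies in `I ^ |T|`. [folklore] -/
theorem prod_mem_pow_card (I : Ideal R) (f : m → R) (T : Finset m) (hf : ∀ r ∈ T, f r ∈ I) :
    ∏ r ∈ T, f r ∈ I ^ T.card := by
  classical
  induction T using Finset.induction_on with
  | empty => simp
  | insert a T ha ih =>
    rw [Finset.prod_insert ha, Finset.card_insert_of_notMem ha, pow_succ']
    exact Ideal.mul_mem_mul (hf a (Finset.mem_insert_self a T))
      (ih fun r hr => hf r (Finset.mem_insert_of_mem hr))

/-- **`a` rows in an ideal with `I^a = 0` kill the determinant.**  If `I ^ a = 0` and at least `a` rows of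
`M` have all their entries in `I`, then `det M = 0` (every Leibniz term contains one entry from each of
these rows). [folklore] -/
theorem det_eq_zero_of_rows_mem_pow (I : Ideal R) {a : ℕ} (hI : I ^ a = ⊥) (M : Matrix m m R)
    (T : Finset m) (hT : a ≤ T.card) (hrows : ∀ r ∈ T, ∀ j, M r j ∈ I) : M.det = 0 := by
  rw [Matrix.det_apply']
  refine Finset.sum_eq_zero fun σ _ => ?_
  have hprod : ∏ i, M (σ i) i = 0 := by
    rw [← Equiv.prod_comp σ.symm (fun i => M (σ i) i)]
    simp only [Equiv.apply_symm_apply]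
    rw [← Finset.prod_mul_prod_compl T]
    have hmem : ∏ r ∈ T, M r (σ.symm r) ∈ I ^ a :=
      Ideal.pow_le_pow_right hT (prod_mem_pow_card I (fun r => M r (σ.symm r)) T fun r hr => hrows r hr _)
    rw [hI, Ideal.mem_bot] at hmem
    rw [hmem, zero_mul]
  rw [hprod, mul_zero]

/-- With all entries in `I`, `I ^ a = 0` and size `≥ a`: `det S = 0`. [folklore] -/
theorem det_eq_zero_of_mem_pow (I : Ideal R) {a : ℕ} (hI : I ^ a = ⊥) (S : Matrix m m R)
    (hS : ∀ i j, S i j ∈ I) (hm : a ≤ Fintype.card m) : S.det = 0 :=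
  det_eq_zero_of_rows_mem_pow I hI S Finset.univ (by rwa [Finset.card_univ]) fun r _ j => hS r j

/-- With all entries in `I`, `I ^ a = 0` and size `≥ a + 1`: `adj S = 0`. [folklore] -/
theorem adjugate_eq_zero_of_mem_pow (I : Ideal R) {a : ℕ} (hI : I ^ a = ⊥) (S : Matrix m m R)
    (hS : ∀ i j, S i j ∈ I) (hm : a + 1 ≤ Fintype.card m) : S.adjugate = 0 := by
  ext i j
  rw [Matrix.adjugate_apply, Matrix.zero_apply]
  refine det_eq_zero_of_rows_mem_pow I hI _ (Finset.univ.erase j) ?_ fun r hr c => ?_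
  · rw [Finset.card_erase_of_mem (Finset.mem_univ j), Finset.card_univ]; omega
  · rw [Matrix.updateRow_ne (Finset.mem_erase.1 hr).1]; exact hS _ _

/-- With all entries in `I`, `I ^ a = 0` and size `≥ a + 2`: every double row replacement of `S` is
singular. [folklore] -/
theorem det_updateRow_updateRow_eq_zero_of_mem_pow (I : Ideal R) {a : ℕ} (hI : I ^ a = ⊥)
    (S : Matrix m m R) (hS : ∀ i j, S i j ∈ I) (hm : a + 2 ≤ Fintype.card m) (r q : m) (y x : m → R) :
    ((S.updateRow r y).updateRow q x).det = 0 := by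
  refine det_eq_zero_of_rows_mem_pow I hI _ ((Finset.univ.erase r).erase q) ?_ fun r' hr' c => ?_
  · have h1 : (Finset.univ.erase r).card = Fintype.card m - 1 := by
      rw [Finset.card_erase_of_mem (Finset.mem_univ r), Finset.card_univ]
    have h3 : ((Finset.univ.erase r).erase q).card ≥ (Finset.univ.erase r).card - 1 :=
      Finset.pred_card_le_card_erase
    omega
  · rw [Matrix.updateRow_ne (Finset.mem_erase.1 hr').1,
      Matrix.updateRow_ne (Finset.mem_erase.1 (Finset.mem_erase.1 hr').2).1]
    exact hS _ _

variable {σ : Type*} [DecidableEq σ] {κ : Type*} [Fintype κ] [DecidableEq κ]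

/-- **Residual corank `≥ ν + 2` with `𝔪^ν = 0`: the second partials of `det A` vanish** at a normal
form `A(x) = diag(1_κ, S)`, `S ∈ Mat_m(I)`, `I ^ ν = 0`, `|m| ≥ ν + 2`. [folklore] -/
theorem eval_pderiv_pderiv_det_eq_zero_of_pow (I : Ideal R) {ν : ℕ} (hI : I ^ ν = ⊥)
    (x : σ → R) (s t : σ) (A : Matrix (κ ⊕ m) (κ ⊕ m) (MvPolynomial σ R))
    (hA : ∀ i j, (A i j).totalDegree ≤ 1) (S : Matrix m m R)
    (hB : A.map (eval x) = Matrix.fromBlocks 1 0 0 S) (hS : ∀ i j, S i j ∈ I)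
    (hm : ν + 2 ≤ Fintype.card m) : eval x (pderiv s (pderiv t A.det)) = 0 := by
  rw [eval_pderiv_pderiv_det_blockNormalForm_general x s t A hA S hB _ _ rfl rfl,
    adjugate_eq_zero_of_mem_pow I hI S hS (by omega), det_eq_zero_of_mem_pow I hI S hS (by omega)]
  simp only [Matrix.zero_mul, Matrix.trace_zero, mul_zero, add_zero,
    det_updateRow_updateRow_eq_zero_of_mem_pow I hI S hS hm, ite_self, Finset.sum_const_zero]

variable [Algebra ℂ R]

/-- **The Hessian of a read-out vanishes at normal forms of residual corank `≥ ν + 2`** when the entries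
of the residual block lie in an ideal `I` with `I ^ ν = 0`. [folklore] -/
theorem hess0_transl_eq_zero_of_pow (I : Ideal R) {ν : ℕ} (hI : I ^ ν = ⊥) (l : R →ₗ[ℂ] ℂ)
    (A : Matrix (κ ⊕ m) (κ ⊕ m) (MvPolynomial σ R)) (F : MvPolynomial σ ℂ)
    (hA : ∀ a b, (A a b).totalDegree ≤ 1) (hF : ∀ d, l (coeff d A.det) = coeff d F)
    (p : σ → ℂ) (S : Matrix m m R)
    (hB : A.map (eval fun i => algebraMap ℂ R (p i)) = Matrix.fromBlocks 1 0 0 S)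
    (hS : ∀ i j, S i j ∈ I) (hm : ν + 2 ≤ Fintype.card m) : hess0 (transl p F) = 0 := by
  ext s t
  rw [hess0_transl_readOut l hF p s t,
    eval_pderiv_pderiv_det_eq_zero_of_pow I hI _ s t A hA S hB hS hm, map_zero, Matrix.zero_apply]

end PowIdeal

/-! ### Every coefficient algebra: the Hessian vanishes at points of residual corank `≥ ν + 2` -/

section Points

variable {ι κ m σ : Type*} [Fintype ι] [DecidableEq ι] [Fintype κ] [DecidableEq κ] [Fintype m]
  [DecidableEq m] [Fintype σ] [DecidableEq σ] {R : Type*} [CommRing R] [Algebra ℂ R]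

/-- **Residual corank `≥ ν + 2`: the Hessian vanishes, for every coefficient algebra.**  Let `φ` be a
character of `R` with `(ker φ)^ν = 0`, `F = λ(det A)` with `A` affine, and `p` a point with a residually
maximal minor `(r, c)` of `A(p)` of co-size `|m| ≥ ν + 2`.  Then `rank Hess F(p) = 0`.  So for a local
type `R` only the residual coranks `3 ≤ q ≤ ν(R) + 1` of the input `LocalHessianBound₃` carry content
(`ν(R)` the nilpotency index of `𝔪`, at most `dim R`). [cite: MignonRessayre2004, §2] -/
theorem hess0_transl_rank_eq_zero_of_pow_point (φ : R →ₐ[ℂ] ℂ) {ν : ℕ}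
    (hker : RingHom.ker (φ : R →+* ℂ) ^ ν = ⊥) (l : R →ₗ[ℂ] ℂ)
    (A : Matrix ι ι (MvPolynomial σ R)) (F : MvPolynomial σ ℂ) (hA : ∀ a b, (A a b).totalDegree ≤ 1)
    (hF : ∀ d, l (coeff d A.det) = coeff d F) (p : σ → ℂ) (r c : κ → ι)
    (hu : φ ((A.map (eval fun i => algebraMap ℂ R (p i))).submatrix r c).det ≠ 0)
    (hmax : ∀ a b : ι, φ ((A.map (eval fun i => algebraMap ℂ R (p i))).submatrix
      (Sum.elim r fun _ : Unit => a) (Sum.elim c fun _ : Unit => b)).det = 0)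
    (hcard : Fintype.card ι = Fintype.card κ + Fintype.card m) (hm : ν + 2 ≤ Fintype.card m) :
    (hess0 (transl p F)).rank = 0 := by
  refine Nat.le_zero.1 (rank_hess0_transl_le_of_maximal_minor (m := m) φ hker l A F hA hF p r c hu hmax
    hcard fun l' A' S hA' hF' hB' hS => ?_)
  rw [hess0_transl_eq_zero_of_pow (RingHom.ker (φ : R →+* ℂ)) hker l' A' F hA' hF' p S hB'
    (fun i j => by simpa using hS i j) hm, Matrix.rank_zero]

end Points

end Summit.ValiantsHypothesis.ValiantsHypothesis.Theorems.GrenetZeonPolySizeQPAlgebra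

end
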